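import Literature.NumberTheory.Connes2026.SemilocalCutoffScaleInvariance
import HarnessLib

/-!
# The reflection `R` of `L²(ℝ)`, the orthogonal projection onto `L²(ℝ)_ev` (`P_ev = ½(1 + R)`), and the
# compression of Hilbert–Schmidt pairings to `L²(ℝ)_ev`: `Σ_{ev basis} ⟨A f_i, B f_i⟩ = Σ_{L² basis} ⟨A P_ev c_k, B P_ev c_k⟩`

LABEL (line 1): RH-FREE literature (theorems + one `def` — the reflection operator; NO named fact).  bears_on:
LADDER-RH W-C/W-P (C1 named-fact debt), cell `rh-crit`, sub-cell cc, overflow row O1 — infrastructure for the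
trace VALUE step of the "annulus road" under `Connes1999_thm_VII_4_rat` (traces over `L²(ℝ)_ev` versus traces
over `L²(ℝ)`).  WHAT THIS IS NOT: any claim about positivity, Weil's criterion or RH.

Sources.  A. Connes, C. Consani, H. Moscovici (2024) [`ConnesConsaniMoscovici2024`], Def. 4.5 §4.6 (`L²(ℝ)_ev`);
A. Connes, Selecta Math. 5 (1999) [`Connes1999`], §VII Thm 4 (trace along an orthonormal basis of the even
space); M. Reed, B. Simon (1972) [`ReedSimon1972`], Thm. VI.22, VI.24.

## What is proved

* `reflectL2` (`(R u)(x) = u(−x)`), `reflectL2_coeFn`, `reflectL2_reflectL2` (`R² = 1`), `inner_reflectL2_reflectL2`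
  (`R` preserves inner products), `mem_evenPart_iff_reflectL2_eq` (`u ∈ L²(ℝ)_ev ↔ R u = u`);
* **`starProjection_evenPart_eq`** — `P_ev u = ½ (u + R u)` (the projection of `u − ½(u + Ru) = ½(u − Ru)` onto
  even functions vanishes: `⟨e, w⟩ = ⟨Re, Rw⟩ = −⟨e, w⟩` for `e` even, `w` odd);
* **`hasSum_inner_evenPart_iff`** — for bounded `A, B` Hilbert–Schmidt along a Hilbert basis `(c_k)` of `L²(ℝ)`
  and a Hilbert basis `(f_i)` of `L²(ℝ)_ev`: `Σ_i ⟨A f_i, B f_i⟩ = S ↔ Σ_k ⟨A P_ev c_k, B P_ev c_k⟩ = S`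
  (polarization of the tree's `hasSum_norm_sq_comp_starProjection_iff`); hence
  `tsum_inner_evenPart_eq` — the even-space pairing equals the full-space pairing of `A P_ev`, `B P_ev`.

No instance, notation or attribute.
-/

noncomputable section

open _root_.MeasureTheory Complex Set Filter
open scoped Real Topology ComplexConjugate ENNReal InnerProductSpace

namespace Literature.NumberTheory.Connes2026

open Literature.NumberTheory.LFunctions Literature.Analysis.OperatorTheory
open Literature.NumberTheory.ConnesConsani
open Literature.NumberTheory.ConnesConsani2024
open Literature.NumberTheory.ConnesConsani2021 hiding cutoffProj cutoffProj_coeFn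

/-! ## §1. The reflection -/

/-- **The reflection `(R u)(x) = u(−x)`** of `L²(ℝ)` (composition with the measure-preserving `x ↦ −x`). [cite: ConnesConsaniMoscovici2024, Def. 4.5 §4.6 p. 14 (`L²(ℝ)_ev` = fixed points of the reflection)] -/
def reflectL2 : Lp ℂ 2 (volume : Measure ℝ) →L[ℂ] Lp ℂ 2 (volume : Measure ℝ) :=
  (Lp.compMeasurePreservingₗᵢ ℂ (fun x : ℝ => -x) (Measure.measurePreserving_neg (volume : Measure ℝ))).toContinuousLinearMap

/-- `(R u)(x) = u(−x)` a.e. [cite: ConnesConsaniMoscovici2024, Def. 4.5 §4.6 p. 14] -/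
theorem reflectL2_coeFn (u : Lp ℂ 2 (volume : Measure ℝ)) :
    (reflectL2 u : ℝ → ℂ) =ᵐ[volume] fun x => (u : ℝ → ℂ) (-x) :=
  Lp.coeFn_compMeasurePreserving u (Measure.measurePreserving_neg (volume : Measure ℝ))

/-- `R` preserves inner products. [cite: ConnesConsaniMoscovici2024, Def. 4.5 §4.6 p. 14] -/
theorem inner_reflectL2_reflectL2 (u v : Lp ℂ 2 (volume : Measure ℝ)) : ⟪reflectL2 u, reflectL2 v⟫_ℂ = ⟪u, v⟫_ℂ :=
  (Lp.compMeasurePreservingₗᵢ ℂ (fun x : ℝ => -x) (Measure.measurePreserving_neg (volume : Measure ℝ))).inner_map_map u v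

/-- `R² = 1`. [cite: ConnesConsaniMoscovici2024, Def. 4.5 §4.6 p. 14] -/
theorem reflectL2_reflectL2 (u : Lp ℂ 2 (volume : Measure ℝ)) : reflectL2 (reflectL2 u) = u := by
  refine Lp.ext ?_
  have h1 := reflectL2_coeFn (reflectL2 u)
  have h2 := reflectL2_coeFn u
  have h2' : (fun x => (reflectL2 u : ℝ → ℂ) (-x)) =ᵐ[volume] fun x => (u : ℝ → ℂ) (-(-x)) :=
    (Measure.measurePreserving_neg (volume : Measure ℝ)).quasiMeasurePreserving.ae_eq_comp h2
  filter_upwards [h1, h2'] with x hx hx'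
  rw [hx, hx', neg_neg]

/-- `u ∈ L²(ℝ)_ev ↔ R u = u`. [cite: ConnesConsaniMoscovici2024, Def. 4.5 §4.6 p. 14] -/
theorem mem_evenPart_iff_reflectL2_eq {u : Lp ℂ 2 (volume : Measure ℝ)} : u ∈ evenPart ↔ reflectL2 u = u := by
  rw [mem_evenPart_iff]
  constructor
  · intro h
    exact Lp.ext ((reflectL2_coeFn u).trans h)
  · intro h
    have h1 := reflectL2_coeFn u
    rw [h] at h1
    exact h1.symm

/-! ## §2. The orthogonal projection onto `L²(ℝ)_ev` -/

/-- `½(u + Ru)` is even. [cite: ConnesConsaniMoscovici2024, Def. 4.5 §4.6 p. 14] -/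
theorem half_add_reflectL2_mem_evenPart (u : Lp ℂ 2 (volume : Measure ℝ)) :
    (2 : ℂ)⁻¹ • (u + reflectL2 u) ∈ evenPart := by
  rw [mem_evenPart_iff_reflectL2_eq, map_smul, map_add, reflectL2_reflectL2, add_comm]

/-- `u − ½(u + Ru) = ½(u − Ru)` is orthogonal to `L²(ℝ)_ev` (`⟨e, w⟩ = ⟨Re, Rw⟩ = −⟨e, w⟩`). [cite: ConnesConsaniMoscovici2024, Def. 4.5 §4.6 p. 14] -/
theorem sub_half_add_reflectL2_mem_orthogonal (u : Lp ℂ 2 (volume : Measure ℝ)) :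
    u - (2 : ℂ)⁻¹ • (u + reflectL2 u) ∈ evenPartᗮ := by
  rw [Submodule.mem_orthogonal]
  intro e he
  have hw : reflectL2 (u - (2 : ℂ)⁻¹ • (u + reflectL2 u)) = -(u - (2 : ℂ)⁻¹ • (u + reflectL2 u)) := by
    rw [map_sub, map_smul, map_add, reflectL2_reflectL2]
    module
  have h := inner_reflectL2_reflectL2 e (u - (2 : ℂ)⁻¹ • (u + reflectL2 u))
  rw [mem_evenPart_iff_reflectL2_eq.mp he, hw, inner_neg_right] at h
  -- `-x = x` in `ℂ` forces `x = 0`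
  have h2 : (2 : ℂ) * ⟪e, u - (2 : ℂ)⁻¹ • (u + reflectL2 u)⟫_ℂ = 0 := by linear_combination -h
  simpa using h2

/-- **`P_ev u = ½(u + Ru)`**: the orthogonal projection onto `L²(ℝ)_ev`. [cite: ConnesConsaniMoscovici2024, Def. 4.5 §4.6 p. 14; Connes1999, §VII Thm 4 (arXiv p0013:L1)] -/
theorem starProjection_evenPart_eq [evenPart.HasOrthogonalProjection] (u : Lp ℂ 2 (volume : Measure ℝ)) :
    (evenPart : Submodule ℂ (Lp ℂ 2 (volume : Measure ℝ))).starProjection u = (2 : ℂ)⁻¹ • (u + reflectL2 u) :=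
  Submodule.eq_starProjection_of_mem_orthogonal (half_add_reflectL2_mem_evenPart u)
    (sub_half_add_reflectL2_mem_orthogonal u)

/-! ## §3. Compression of Hilbert–Schmidt pairings to `L²(ℝ)_ev` -/

section Pairing

variable {F : Type*} [NormedAddCommGroup F] [InnerProductSpace ℂ F] [CompleteSpace F]

/-- **Even-space pairing = full-space pairing of the compressed operators**: for bounded
`A, B : L²(ℝ) → F`, a Hilbert basis `(f_i)` of `L²(ℝ)_ev` and a Hilbert basis `(c_k)` of `L²(ℝ)` along which
`A P_ev`, `B P_ev` are Hilbert–Schmidt, `Σ_i ⟨A f_i, B f_i⟩ = Σ_k ⟨A P_ev c_k, B P_ev c_k⟩` (both absolutely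
convergent) — polarization of `Σ_i ‖T f_i‖² = Σ_k ‖T P_ev c_k‖²`. [cite: ReedSimon1972, Thm. VI.22 (e), Thm. VI.24, PDF pp. 198–199] -/
theorem tsum_inner_evenPart_eq [evenPart.HasOrthogonalProjection] {ι κ : Type*}
    (f : HilbertBasis ι ℂ (evenPart : Submodule ℂ (Lp ℂ 2 (volume : Measure ℝ))))
    (c : HilbertBasis κ ℂ (Lp ℂ 2 (volume : Measure ℝ))) (A B : Lp ℂ 2 (volume : Measure ℝ) →L[ℂ] F)
    (hA : Summable fun k => ‖A ((evenPart : Submodule ℂ (Lp ℂ 2 (volume : Measure ℝ))).starProjection (c k))‖ ^ 2)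
    (hB : Summable fun k => ‖B ((evenPart : Submodule ℂ (Lp ℂ 2 (volume : Measure ℝ))).starProjection (c k))‖ ^ 2) :
    ∑' i, ⟪A ((f i : evenPart) : Lp ℂ 2 (volume : Measure ℝ)), B ((f i : evenPart) : Lp ℂ 2 (volume : Measure ℝ))⟫_ℂ =
      ∑' k, ⟪A ((evenPart : Submodule ℂ (Lp ℂ 2 (volume : Measure ℝ))).starProjection (c k)),
        B ((evenPart : Submodule ℂ (Lp ℂ 2 (volume : Measure ℝ))).starProjection (c k))⟫_ℂ := by
  haveI : CompleteSpace (evenPart : Submodule ℂ (Lp ℂ 2 (volume : Measure ℝ))) := completeSpace_evenPart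
  set P := (evenPart : Submodule ℂ (Lp ℂ 2 (volume : Measure ℝ))).starProjection with hP
  -- the four norm-square series, transported by `hasSum_norm_sq_comp_starProjection_iff`
  have hT : ∀ (T : Lp ℂ 2 (volume : Measure ℝ) →L[ℂ] F), Summable (fun k => ‖T (P (c k))‖ ^ 2) →
      ∑' i, ‖T ((f i : evenPart) : Lp ℂ 2 (volume : Measure ℝ))‖ ^ 2 = ∑' k, ‖T (P (c k))‖ ^ 2 := fun T hTs => by
    have h := (hasSum_norm_sq_comp_starProjection_iff f c T).2 hTs.hasSum
    exact h.tsum_eq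
  -- summabilities along `f`
  have hsA : Summable fun i => ‖A ((f i : evenPart) : Lp ℂ 2 (volume : Measure ℝ))‖ ^ 2 :=
    ((hasSum_norm_sq_comp_starProjection_iff f c A).2 hA.hasSum).summable
  have hsB : Summable fun i => ‖B ((f i : evenPart) : Lp ℂ 2 (volume : Measure ℝ))‖ ^ 2 :=
    ((hasSum_norm_sq_comp_starProjection_iff f c B).2 hB.hasSum).summable
  -- polarization on both sides
  have hpolL : ∀ i, ⟪A ((f i : evenPart) : Lp ℂ 2 (volume : Measure ℝ)), B ((f i : evenPart) : Lp ℂ 2 (volume : Measure ℝ))⟫_ℂ =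
      ((((‖(A + B) ((f i : evenPart) : Lp ℂ 2 (volume : Measure ℝ))‖ : ℂ) ^ 2) - ((‖(A - B) ((f i : evenPart) : Lp ℂ 2 (volume : Measure ℝ))‖ : ℂ) ^ 2)) +
        ((((‖(A - Complex.I • B) ((f i : evenPart) : Lp ℂ 2 (volume : Measure ℝ))‖ : ℂ) ^ 2) - ((‖(A + Complex.I • B) ((f i : evenPart) : Lp ℂ 2 (volume : Measure ℝ))‖ : ℂ) ^ 2)) * Complex.I)) / 4 :=
    fun i => by
      rw [inner_eq_sum_norm_sq_div_four]
      simp only [add_apply, sub_apply, smul_apply]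
      rfl
  have hpolR : ∀ k, ⟪A (P (c k)), B (P (c k))⟫_ℂ =
      ((((‖(A + B) (P (c k))‖ : ℂ) ^ 2) - ((‖(A - B) (P (c k))‖ : ℂ) ^ 2)) +
        ((((‖(A - Complex.I • B) (P (c k))‖ : ℂ) ^ 2) - ((‖(A + Complex.I • B) (P (c k))‖ : ℂ) ^ 2)) * Complex.I)) / 4 :=
    fun k => by
      rw [inner_eq_sum_norm_sq_div_four]
      simp only [add_apply, sub_apply, smul_apply]
      rfl
  -- summability of the four combination operators along `P c`
  have hS : ∀ (a : ℂ), Summable fun k => ‖(A + a • B) (P (c k))‖ ^ 2 := fun a => by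
    refine Summable.of_nonneg_of_le (fun _ => sq_nonneg _) (fun k => ?_) ((hA.add hB).mul_left (2 * (1 + ‖a‖ ^ 2)))
    simp only [add_apply, smul_apply]
    have h1 := norm_add_le (A (P (c k))) (a • B (P (c k)))
    rw [norm_smul] at h1
    have hx := norm_nonneg (A (P (c k)))
    have hy := norm_nonneg (B (P (c k)))
    have ha := norm_nonneg a
    have h2 : ‖A (P (c k)) + a • B (P (c k))‖ ^ 2 ≤ (‖A (P (c k))‖ + ‖a‖ * ‖B (P (c k))‖) ^ 2 :=
      pow_le_pow_left₀ (norm_nonneg _) h1 2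
    nlinarith [h2, sq_nonneg (‖A (P (c k))‖ - ‖a‖ * ‖B (P (c k))‖), mul_nonneg (sq_nonneg ‖a‖) (sq_nonneg ‖A (P (c k))‖),
      sq_nonneg ‖B (P (c k))‖]
  have e1 := hT (A + B) (by simpa using hS 1)
  have e2 := hT (A - B) (by simpa [sub_eq_add_neg] using hS (-1))
  have e3 := hT (A - Complex.I • B) (by simpa [sub_eq_add_neg, neg_smul] using hS (-Complex.I))
  have e4 := hT (A + Complex.I • B) (hS Complex.I)
  -- assemble: both sides are the same combination of the four real series
  have hsumL : Summable fun i => ⟪A ((f i : evenPart) : Lp ℂ 2 (volume : Measure ℝ)),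
      B ((f i : evenPart) : Lp ℂ 2 (volume : Measure ℝ))⟫_ℂ := summable_inner_of_summable_norm_sq hsA hsB
  have hsumR : Summable fun k => ⟪A (P (c k)), B (P (c k))⟫_ℂ := summable_inner_of_summable_norm_sq hA hB
  simp_rw [hpolL, hpolR]
  have hre : ∀ (T : Lp ℂ 2 (volume : Measure ℝ) →L[ℂ] F), Summable (fun k => ‖T (P (c k))‖ ^ 2) →
      (∑' i, ((‖T ((f i : evenPart) : Lp ℂ 2 (volume : Measure ℝ))‖ : ℂ) ^ 2)) = ∑' k, ((‖T (P (c k))‖ : ℂ) ^ 2) :=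
    fun T hTs => by
      have hl : Summable fun i => ‖T ((f i : evenPart) : Lp ℂ 2 (volume : Measure ℝ))‖ ^ 2 :=
        ((hasSum_norm_sq_comp_starProjection_iff f c T).2 hTs.hasSum).summable
      have h1 := (Complex.hasSum_ofReal.mpr hl.hasSum)
      have h2 := (Complex.hasSum_ofReal.mpr hTs.hasSum)
      simp only [Complex.ofReal_pow] at h1 h2
      rw [h1.tsum_eq, h2.tsum_eq, hT T hTs]
  have s1 := hS 1; have s2 := hS (-1); have s3 := hS (-Complex.I); have s4 := hS Complex.I
  simp only [one_smul, neg_smul, ← sub_eq_add_neg] at s1 s2 s3 s4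
  have c1 := hre (A + B) s1
  have c2 := hre (A - B) s2
  have c3 := hre (A - Complex.I • B) s3
  have c4 := hre (A + Complex.I • B) s4
  -- summability in `ℂ` of each of the four series on both sides
  have sc : ∀ (T : Lp ℂ 2 (volume : Measure ℝ) →L[ℂ] F), Summable (fun k => ‖T (P (c k))‖ ^ 2) →
      Summable (fun i => ((‖T ((f i : evenPart) : Lp ℂ 2 (volume : Measure ℝ))‖ : ℂ) ^ 2)) ∧
      Summable (fun k => ((‖T (P (c k))‖ : ℂ) ^ 2)) := fun T hTs => by
    have hl : Summable fun i => ‖T ((f i : evenPart) : Lp ℂ 2 (volume : Measure ℝ))‖ ^ 2 :=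
      ((hasSum_norm_sq_comp_starProjection_iff f c T).2 hTs.hasSum).summable
    have h1 := (Complex.hasSum_ofReal.mpr hl.hasSum)
    have h2 := (Complex.hasSum_ofReal.mpr hTs.hasSum)
    simp only [Complex.ofReal_pow] at h1 h2
    exact ⟨h1.summable, h2.summable⟩
  obtain ⟨l1, r1⟩ := sc (A + B) s1
  obtain ⟨l2, r2⟩ := sc (A - B) s2
  obtain ⟨l3, r3⟩ := sc (A - Complex.I • B) s3
  obtain ⟨l4, r4⟩ := sc (A + Complex.I • B) s4
  rw [tsum_div_const, tsum_div_const, (l1.sub l2).tsum_add ((l3.sub l4).mul_right _),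
    (r1.sub r2).tsum_add ((r3.sub r4).mul_right _), l1.tsum_sub l2, r1.tsum_sub r2, tsum_mul_right, tsum_mul_right,
    l3.tsum_sub l4, r3.tsum_sub r4, c1, c2, c3, c4]

end Pairing

end Literature.NumberTheory.Connes2026
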